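import Literature.NumberTheory.Automorphic.CuspidalCohomologyGL
import Literature.NumberTheory.Automorphic.CompletedCohomology
import Literature.Algebra.Homology.GroupCohomologyCentralElement
import HarnessLib

/-!
# Hecke operators of central elements on twisted cohomology: the central character

Topic `NumberTheory/Automorphic`; namespace `Literature.NumberTheory.Automorphic`, grouping
sub-namespaces `ArithmeticQuotient` / `TwistedQuotient` (as `CuspidalCohomologyGL`).  A *proofs*
file (theorems only).

For the cohomology `H^q(S_L, Ṽ) = H^q(Γ, Fun(𝒢 ⧸ L, V))` with TWISTED coefficients
(`TwistedQuotient.cohomology ι L ρ q`, `(γ f)(xL) = ρ(γ) f(ι(γ)⁻¹ x L)`) and a CENTRAL element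
`g ∈ Z(𝒢)`:

* the double coset `L g L` is the single coset `g L`, so `T_g = [L g L]` is right translation,
  `(T_g f)(xL) = f(x g L)` (`heckeFun_apply_coe_of_mem_center`); consequently `g ↦ T_g` is
  multiplicative on the centre and trivial on `Z(𝒢) ∩ L` (`heckeRepHom_mul_of_mem_center`,
  `heckeRepHom_eq_id_of_mem_center_of_mem`, and on `H^q`: `heckeEnd_mul_of_mem_center`,
  `heckeEnd_eq_id_of_mem_center_of_mem`) — the central Hecke operators form a representation of
  `Z(𝒢) / (Z(𝒢) ∩ L)`;
* **global central elements act through the central character of the coefficients**: if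
  `z ∈ Z(Γ)` has central image `ι z ∈ Z(𝒢)` and acts on `V` by the scalar `ω` (`ρ z = ω · id`),
  then `T_{ι z} = ω • (action of z⁻¹ ∈ Z(Γ))` on `Fun(𝒢 ⧸ L, V)`
  (`heckeRepHom_eq_smul_centralEnd`), hence, central elements of `Γ` acting trivially on
  `H^q(Γ, ·)` (`Literature.Algebra.Homology.map_centralEnd`), **`T_{ι z} = ω` on `H^q(S_L, Ṽ)`**
  (`heckeEnd_apply_of_mem_center`).  For `GL_n` and `z = a · 1`, `a ∈ F^×`, this is the statement
  that the central character of a Hecke eigensystem occurring in `H^q(X_U, Ṽ_wt)` is an algebraic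
  Hecke character of infinity type given by `wt` [Harder1987, §2], the untwisted case `ω = 1`
  being the tree's `heckeEnd_eq_id_of_central` (`HidaTowerCentralHecke`).

Also: `groupCohomology.map (MonoidHom.id G)` is `k`-linear in the morphism
(`map_id_smul_apply`; Mathlib records additivity only).

## References

* G. Harder, *Eisenstein cohomology of arithmetic groups. The case GL₂*, Invent. Math. 89 (1987), §2
  [Harder1987].
* G. Shimura, *Introduction to the arithmetic theory of automorphic functions* (1971), Ch. 3, §3.1
  [ShimuraIATAF1971].
* J.-P. Serre, *Local Fields*, Ch. VII §5, Prop. 3 [SerreLocalFields1979].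
-/

noncomputable section

open CategoryTheory groupCohomology

universe u

namespace Literature.NumberTheory.Automorphic

/-! ### `k`-linearity of `groupCohomology.map` in the morphism -/

namespace TwistedQuotient

section Linear

variable {k : Type u} [CommRing k] {G : Type u} [Group G] {A B : Rep k G}

/-- On cocycles, `Z^n(id, r • φ) = r • Z^n(id, φ)`. [folklore] -/
theorem cocyclesMap_id_smul_apply (r : k) (φ : A ⟶ B) (n : ℕ) (z : cocycles A n) :
    (cocyclesMap (MonoidHom.id G) (r • φ) n).hom z =
      r • (cocyclesMap (MonoidHom.id G) φ n).hom z := by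
  apply (ModuleCat.mono_iff_injective (iCocycles B n)).1 inferInstance
  rw [map_smul]
  change (cocyclesMap (MonoidHom.id G) (r • φ) n ≫ iCocycles B n).hom z =
    r • (cocyclesMap (MonoidHom.id G) φ n ≫ iCocycles B n).hom z
  rw [HomologicalComplex.cyclesMap_i, HomologicalComplex.cyclesMap_i, ModuleCat.hom_comp,
    ModuleCat.hom_comp, LinearMap.comp_apply, LinearMap.comp_apply,
    cochainsMap_id_f_hom_eq_compLeft, cochainsMap_id_f_hom_eq_compLeft]
  rfl

/-- **`Hⁿ(id, r • φ) = r • Hⁿ(id, φ)`**: functoriality of group cohomology in the coefficients is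
`k`-linear. [folklore] -/
theorem map_id_smul_apply (r : k) (φ : A ⟶ B) (n : ℕ) (x : groupCohomology A n) :
    (groupCohomology.map (MonoidHom.id G) (r • φ) n).hom x =
      r • (groupCohomology.map (MonoidHom.id G) φ n).hom x := by
  induction x using groupCohomology_induction_on with
  | h z =>
  change (groupCohomology.π A n ≫ groupCohomology.map (MonoidHom.id G) (r • φ) n).hom z =
    r • (groupCohomology.π A n ≫ groupCohomology.map (MonoidHom.id G) φ n).hom z
  rw [groupCohomology.π_map, groupCohomology.π_map, ModuleCat.hom_comp, ModuleCat.hom_comp,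
    LinearMap.comp_apply, LinearMap.comp_apply, cocyclesMap_id_smul_apply, map_smul]

end Linear

end TwistedQuotient

/-! ### Double cosets of central elements -/

namespace ArithmeticQuotient

variable (k : Type u) [CommRing k] {𝒢 : Type u} [Group 𝒢] (L : Subgroup 𝒢)
  (M : Type u) [AddCommGroup M] [Module k M]

variable {k M} in
/-- For `g` central, `L g L / L = {g L}`. [cite: ShimuraIATAF1971, Ch. 3, §3.1] -/
theorem doubleCosetQuot_eq_singleton_of_mem_center {g : 𝒢} (hg : g ∈ Subgroup.center 𝒢) :
    doubleCosetQuot L g = {(g : 𝒢 ⧸ L)} := by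
  ext d
  simp only [Set.mem_singleton_iff, doubleCosetQuot]
  constructor
  · rintro ⟨m, rfl⟩
    change ((m : 𝒢) • (g : 𝒢 ⧸ L)) = _
    rw [MulAction.Quotient.smul_coe, smul_eq_mul, Subgroup.mem_center_iff.1 hg (m : 𝒢)]
    exact QuotientGroup.mk_mul_of_mem g m.2
  · rintro rfl
    exact MulAction.mem_orbit_self _

/-- **For `g` central, `T_g` is right (= left) translation by `g`**: `(T_g f)(xL) = f(x g L)`.
[cite: ShimuraIATAF1971, Ch. 3, §3.1] -/
theorem heckeFun_apply_coe_of_mem_center {g : 𝒢} (hg : g ∈ Subgroup.center 𝒢) (f : (𝒢 ⧸ L) → M)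
    (x : 𝒢) : heckeFun k L g M f (x : 𝒢 ⧸ L) = f ((x * g : 𝒢) : 𝒢 ⧸ L) := by
  classical
  have hfin : (doubleCosetQuot L g).Finite := by
    rw [doubleCosetQuot_eq_singleton_of_mem_center L hg]; exact Set.finite_singleton _
  have hset : hfin.toFinset = {(g : 𝒢 ⧸ L)} :=
    Finset.ext fun d => by
      rw [Set.Finite.mem_toFinset, doubleCosetQuot_eq_singleton_of_mem_center L hg]; simp
  rw [heckeFun_apply_coe k L M g f x hfin, hset, Finset.sum_singleton, MulAction.Quotient.smul_coe,
    smul_eq_mul]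

/-- Pointwise form: for `g` central, `T_g f = f ∘ (g • ·)`. [folklore] -/
theorem heckeFun_apply_of_mem_center {g : 𝒢} (hg : g ∈ Subgroup.center 𝒢) (f : (𝒢 ⧸ L) → M)
    (c : 𝒢 ⧸ L) : heckeFun k L g M f c = f (g • c) := by
  induction c using QuotientGroup.induction_on with
  | H x =>
    rw [heckeFun_apply_coe_of_mem_center k L M hg f x, MulAction.Quotient.smul_coe, smul_eq_mul,
      Subgroup.mem_center_iff.1 hg x]

/-- For central `g, g'`: `T_{g g'} = T_g ∘ T_{g'}` on `Fun(𝒢 ⧸ L, M)`. [cite: ShimuraIATAF1971, Ch. 3, §3.1] -/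
theorem heckeFun_mul_of_mem_center {g g' : 𝒢} (hg : g ∈ Subgroup.center 𝒢)
    (hg' : g' ∈ Subgroup.center 𝒢) (f : (𝒢 ⧸ L) → M) :
    heckeFun k L (g * g') M f = heckeFun k L g M (heckeFun k L g' M f) := by
  funext c
  rw [heckeFun_apply_of_mem_center k L M (mul_mem hg hg'), heckeFun_apply_of_mem_center k L M hg,
    heckeFun_apply_of_mem_center k L M hg', ← mul_smul, Subgroup.mem_center_iff.1 hg g']

/-- For central `g ∈ L`: `T_g = id` on `Fun(𝒢 ⧸ L, M)`. [folklore] -/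
theorem heckeFun_apply_of_mem_center_of_mem {g : 𝒢} (hg : g ∈ Subgroup.center 𝒢) (hgL : g ∈ L)
    (f : (𝒢 ⧸ L) → M) : heckeFun k L g M f = f := by
  funext c
  induction c using QuotientGroup.induction_on with
  | H x =>
    rw [heckeFun_apply_coe_of_mem_center k L M hg f x, QuotientGroup.mk_mul_of_mem x hgL]

end ArithmeticQuotient

/-! ### Central Hecke operators on twisted cohomology -/

namespace TwistedQuotient

variable {k : Type u} [CommRing k] {Γ 𝒢 : Type u} [Group Γ] [Group 𝒢]
variable (ι : Γ →* 𝒢) (L : Subgroup 𝒢) {V : Type u} [AddCommGroup V] [Module k V]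
  (ρ : Representation k Γ V)

/-- For central `g, g'`: `[L g g' L] = [L g' L] ≫ [L g L]` as endomorphisms of the representation
`Fun(𝒢 ⧸ L, V)`. [cite: ShimuraIATAF1971, Ch. 3, §3.1] -/
theorem heckeRepHom_mul_of_mem_center {g g' : 𝒢} (hg : g ∈ Subgroup.center 𝒢)
    (hg' : g' ∈ Subgroup.center 𝒢) :
    heckeRepHom ι L ρ (g * g') = heckeRepHom ι L ρ g' ≫ heckeRepHom ι L ρ g := by
  refine Rep.hom_ext (Representation.IntertwiningMap.ext (LinearMap.ext fun f => ?_))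
  change ArithmeticQuotient.heckeFun k L (g * g') V f =
    ArithmeticQuotient.heckeFun k L g V (ArithmeticQuotient.heckeFun k L g' V f)
  exact ArithmeticQuotient.heckeFun_mul_of_mem_center k L V hg hg' f

/-- For central `g ∈ L`: `[L g L] = 𝟙`. [folklore] -/
theorem heckeRepHom_eq_id_of_mem_center_of_mem {g : 𝒢} (hg : g ∈ Subgroup.center 𝒢) (hgL : g ∈ L) :
    heckeRepHom ι L ρ g = 𝟙 (coeffRep ι L ρ) := by
  refine Rep.hom_ext (Representation.IntertwiningMap.ext (LinearMap.ext fun f => ?_))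
  change ArithmeticQuotient.heckeFun k L g V f = f
  exact ArithmeticQuotient.heckeFun_apply_of_mem_center_of_mem k L V hg hgL f

/-- **Central Hecke operators are multiplicative on `H^q(S_L, Ṽ)`**: `T_{g g'} = T_g ∘ T_{g'}` for
`g, g'` central. [cite: ShimuraIATAF1971, Ch. 3, §3.1] -/
theorem heckeEnd_mul_of_mem_center {g g' : 𝒢} (hg : g ∈ Subgroup.center 𝒢)
    (hg' : g' ∈ Subgroup.center 𝒢) (q : ℕ) (x : cohomology ι L ρ q) :
    heckeEnd ι L ρ (g * g') q x = heckeEnd ι L ρ g q (heckeEnd ι L ρ g' q x) := by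
  change (groupCohomology.map (MonoidHom.id Γ) (heckeRepHom ι L ρ (g * g')) q).hom x =
    (heckeOperator ι L ρ g' q ≫ heckeOperator ι L ρ g q).hom x
  rw [heckeRepHom_mul_of_mem_center ι L ρ hg hg', heckeOperator, heckeOperator,
    ← groupCohomology.map_id_comp]

/-- Central Hecke operators commute on `H^q(S_L, Ṽ)`. [folklore] -/
theorem heckeEnd_comm_of_mem_center {g g' : 𝒢} (hg : g ∈ Subgroup.center 𝒢)
    (hg' : g' ∈ Subgroup.center 𝒢) (q : ℕ) (x : cohomology ι L ρ q) :
    heckeEnd ι L ρ g q (heckeEnd ι L ρ g' q x) = heckeEnd ι L ρ g' q (heckeEnd ι L ρ g q x) := by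
  rw [← heckeEnd_mul_of_mem_center ι L ρ hg hg', ← heckeEnd_mul_of_mem_center ι L ρ hg' hg,
    Subgroup.mem_center_iff.1 hg' g]

/-- **Central elements of the level act trivially**: `T_g = id` on `H^q(S_L, Ṽ)` for `g ∈ Z(𝒢) ∩ L`.
[folklore] -/
theorem heckeEnd_eq_id_of_mem_center_of_mem {g : 𝒢} (hg : g ∈ Subgroup.center 𝒢) (hgL : g ∈ L)
    (q : ℕ) (x : cohomology ι L ρ q) : heckeEnd ι L ρ g q x = x := by
  change (groupCohomology.map (MonoidHom.id Γ) (heckeRepHom ι L ρ g) q).hom x = x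
  rw [heckeRepHom_eq_id_of_mem_center_of_mem ι L ρ hg hgL, groupCohomology.map_id]
  rfl

/-- **`T_{ι z} = ω • (z⁻¹ acting)` on `Fun(𝒢 ⧸ L, V)`** for `z ∈ Z(Γ)` with `ι z ∈ Z(𝒢)` acting on
`V` by the scalar `ω`: `(T_{ι z} f)(xL) = f(ι z • xL) = ρ(z) ρ(z⁻¹) f(ι(z⁻¹)⁻¹ • xL) = ω • (z⁻¹ f)(xL)`.
[cite: Harder1987, §2] -/
theorem heckeRepHom_eq_smul_centralEnd {z : Γ} (hzΓ : z ∈ Subgroup.center Γ)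
    (hz : ι z ∈ Subgroup.center 𝒢) {ω : k} (hω : ∀ v : V, ρ z v = ω • v) :
    heckeRepHom ι L ρ (ι z) =
      ω • Literature.Algebra.Homology.centralEnd (coeffRep ι L ρ) (inv_mem hzΓ) := by
  refine Rep.hom_ext (Representation.IntertwiningMap.ext (LinearMap.ext fun f => funext fun c => ?_))
  rw [Rep.smul_hom]
  change ArithmeticQuotient.heckeFun k L (ι z) V f c =
    ω • (coeffRepresentation ι L ρ z⁻¹ f) c
  rw [ArithmeticQuotient.heckeFun_apply_of_mem_center k L V hz f c, coeffRepresentation_apply,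
    ← hω, ← Module.End.mul_apply, ← map_mul, mul_inv_cancel, map_one, Module.End.one_apply,
    map_inv, inv_inv]

/-- **Global central elements act on `H^q(S_L, Ṽ)` through the central character of the
coefficients**: for `z ∈ Z(Γ)` with `ι z ∈ Z(𝒢)` and `ρ(z) = ω · id_V`, the Hecke operator
`T_{ι z}` is multiplication by `ω` on every `H^q(S_L, Ṽ)` (central elements of `Γ` act trivially
on `H^q(Γ, ·)`). [cite: Harder1987, §2] [cite: SerreLocalFields1979, Ch. VII §5, Prop. 3] -/
theorem heckeEnd_apply_of_mem_center {z : Γ} (hzΓ : z ∈ Subgroup.center Γ)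
    (hz : ι z ∈ Subgroup.center 𝒢) {ω : k} (hω : ∀ v : V, ρ z v = ω • v) (q : ℕ)
    (x : cohomology ι L ρ q) : heckeEnd ι L ρ (ι z) q x = ω • x := by
  change (groupCohomology.map (MonoidHom.id Γ) (heckeRepHom ι L ρ (ι z)) q).hom x = ω • x
  rw [heckeRepHom_eq_smul_centralEnd ι L ρ hzΓ hz hω, map_id_smul_apply,
    Literature.Algebra.Homology.map_centralEnd]
  rfl

/-- The inverse: `T_{ι z⁻¹} = ω⁻¹`, i.e. `ω • T_{(ι z)⁻¹} x = x`. [folklore] -/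
theorem smul_heckeEnd_inv_apply_of_mem_center {z : Γ} (hzΓ : z ∈ Subgroup.center Γ)
    (hz : ι z ∈ Subgroup.center 𝒢) {ω : k} (hω : ∀ v : V, ρ z v = ω • v) (q : ℕ)
    (x : cohomology ι L ρ q) : ω • heckeEnd ι L ρ (ι z)⁻¹ q x = x := by
  rw [← heckeEnd_apply_of_mem_center ι L ρ hzΓ hz hω q, ← map_inv,
    ← heckeEnd_mul_of_mem_center ι L ρ hz (by rw [map_inv]; exact inv_mem hz), ← map_mul,
    mul_inv_cancel, map_one]
  change (heckeOperator ι L ρ 1 q).hom x = x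
  rw [heckeOperator_one]
  rfl

end TwistedQuotient

end Literature.NumberTheory.Automorphic
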